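import Literature.MathematicalPhysics.QuantumFieldTheory.BalabanImbrieJaffe1984to88.BIJ88TripleActivity309

/-!
# `BalabanImbrieJaffe1984to88.BIJ88TripleSplitActivity309` — T. Bałaban, J. Imbrie, A. Jaffe, *Effective action and cluster properties of the
abelian Higgs model*, Commun. Math. Phys. **114** (1988) 257–315 [BalabanImbrieJaffe1988], Sect. 5.14 (5.14.3)–(5.14.4) p. 309 [PDF 53] with
Sect. 5.13 p. 304–307 [PDF 48–51]: **THE GAUSSIAN BOOKKEEPING OF A THREE-CUBE CHAIN WHOSE MIDDLE CUBE HAS TWO FACES AND WHOSE COVARIANCE HAS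
RANGE ONE** — the datum of p36 g18's kernel witness #4 (`BIJ88Ineq5144TripleLocalityWitness`): sites `Fin 4`, cubes `Fin 3` under the cube map
`0 ↦ □₀`, `1, 2 ↦ □₁`, `3 ↦ □₂`, the SPLIT precision `Δ = [[2,1],[1,2]] ⊕ [[2,1],[1,2]]` (site `0` couples to the `□₀`-face site `1` of `□₁`, the
`□₂`-face site `2` of `□₁` couples to site `3`; nothing joins the two faces), so that at EVERY interpolation `s ∈ [0,1]³` the covariance `(Δ_s)⁻¹`
is block diagonal: no covariance at all between the `□₀`-side and the `□₂`-side (`split4_inv_offBlock`) — the `δ → 0` idealisation of print's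
inter-cube decay *"If the walk ω(α) wanders through more than a few cubes, we begin to pickup factors e^{−cr(e_k)}"* (p. 307).

statement-level skeleton of published theorems with citation tags; proofs where landed; nothing here is a claim about the Yang–Mills mass gap

PDF held: `paper:balaban1988-cmp114-bij-abelian-higgs-effective-action` (journal page = PDF page + 256); p. 307 (text layer p0051.txt L10–15),
verbatim: *"Functional derivatives hitting e^{−V^{(k)}(Y)} yield factors e^β(L^kε/ε₀)^{1/4−α}. … Altogether we have small factors at each end of
C_ω(α) (except for contractions to F^{m̄}_{k,loc}(X_{σ₁}).) If the walk ω(α) wanders through more than a few cubes, we begin to pickup factors e^{−cr(e_k)}."* (v1.1 DOC-ONLY: parenthetical corrected per owner r16 g23 — the exception is the OBSERVABLE `F^{m̄}_{k,loc}`, not the source `ℱ`; declarations byte-identical to v1 p351541.)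

WHAT IS PROVED (unit `lit-balaban-p36`, generation 18 of the Phase-2 proof seat p36; SKELETON rows C2.Eq5.14.3-5.14.4 / C2.Eq5.13.3-5.13.4 of
`HOME/lit-balaban-r16/ROWS-C2-part2.md`, owner r16 — Gaussian identities and a datum, no (5.14.4) estimate; HOME/GAPS.md G-C2-p36-11).
* §1 **`integral_exp_neg_sq_sq_div`** — `⟨e^{−φ_a²}e^{−φ_b²}⟩_P = √(det P / det(P + 2E_{bb} + 2E_{aa}))` for `P ≻ 0` (gen 17's one-site value
  `BIJ88Ineq5144PairAdjustmentWitness.integral_exp_neg_sq_div` with the quadratic shift applied twice).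
* §2 `interpForm_corner_apply` (entries of `Δ_{1_Λ}` for a general cube map), `interpForm_corner_univ` (`Δ_{1_univ} = Δ`, p02 `interpForm_one`).
* §3 the datum: `split4_posDef_and_ge` (`Δ ≻ 0`, `Δ ≥ ½·1`), `det_submatrix_univ4`, **`integral_exp_neg_sq_sq_regionLaw4`** (the two-face Gaussian
  value under the eight region laws `1_{Λ′}`), `interpForm_split4_corners` / `split4_dets` (four coupling patterns; determinants `9, 49`, `12, 56`,
  `12, 56`, `16, 64` — values `3/7`, `√(3/14)`, `√(3/14)`, `1/2`, i.e. gen 17's one-site values `√(3/7)` and `√(1/2)` multiplied face by face),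
  **`split4_inv_offBlock`** (`(Δ_s)⁻¹_{xy} = 0` for `x ≠ y` with `Δ_{xy} = 0`, all `s ∈ [0,1]³`: explicit block inverse), `sqrt_windows4`.
HONEST SCOPE: finite-dimensional Gaussian identities and one datum; 0 `sorry`, 0 definitions, 0 `Prop` facts (D-0026);
imports `BIJ88TripleActivity309` (p36 g18; through it gen 17's `integral_exp_neg_sq_div` file); modifies nothing.  NOT summit progress; NOT
continuum; NOT Clay.  Cell `lit-balaban` Phase 2, seat p36 gen 18 (owner r16, referee ref-5).
-/

noncomputable section

open Finset MeasureTheory Matrix ProbabilityTheory Filter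
open Literature.MathematicalPhysics.QuantumFieldTheory.Balaban1983to89
open B2Eq228Conditioning (weight source)
open B13GaugeDevices (gaussWeight gaussNorm)
open Literature.MathematicalPhysics.QuantumFieldTheory.BalabanImbrieJaffe1984to88
open BIJ88DirichletForms305 (interpForm interpForm_apply interpForm_one)
open BIJ88PolymerRep5134 (corner corner_apply)
open BIJ88PolymerRep5134Gauss (prec src)
open BIJ88SlotMomentsGauss308 (fieldLaw integral_fieldLaw)
open BIJ88Eq5145CornerModel (regionLaw prec_interp_corner prec_corner_posDef)
open BIJ88Ineq5144PairAdjustmentWitness (integral_weight_eq_gaussNorm exp_neg_sq_mul_weight)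

namespace Literature.MathematicalPhysics.QuantumFieldTheory.BalabanImbrieJaffe1984to88.BIJ88TripleSplitActivity309

/-! ## §1 The Gaussian expectation of `e^{−φ_a²−φ_b²}` -/
section Gauss

variable {S : Type} [Fintype S] [DecidableEq S]

/-- **`⟨e^{−φ_a²}e^{−φ_b²}⟩_P = √(det P / det(P + 2E_{bb} + 2E_{aa}))`** for a positive definite precision `P` (gen 17's one-site value twice:
`e^{−φ_a²}e^{−φ_b²}e^{−½⟨φ,Pφ⟩} = e^{−½⟨φ,(P + 2E_{bb} + 2E_{aa})φ⟩}`). [cite: BalabanImbrieJaffe1988, p.304 (Sect. 5.13)] -/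
theorem integral_exp_neg_sq_sq_div (P : Matrix S S ℝ) (hP : P.PosDef) (a b : S) :
    (∫ φ, Real.exp (-(φ a) ^ 2) * Real.exp (-(φ b) ^ 2) * weight P φ) / (∫ φ, weight P φ) =
      Real.sqrt P.det / Real.sqrt (P + Matrix.single b b 2 + Matrix.single a a 2).det := by
  have hE : ∀ c : S, (Matrix.single c c (2 : ℝ)).PosSemidef := fun c => by
    rw [← Matrix.diagonal_single]
    exact Matrix.PosSemidef.diagonal fun i => by
      rcases eq_or_ne i c with rfl | h
      · simp
      · simp [h]
  have hP' : (P + Matrix.single b b 2 + Matrix.single a a 2).PosDef := (hP.add_posSemidef (hE b)).add_posSemidef (hE a)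
  have hw : ∀ φ : S → ℝ, Real.exp (-(φ a) ^ 2) * Real.exp (-(φ b) ^ 2) * weight P φ =
      weight (P + Matrix.single b b 2 + Matrix.single a a 2) φ := fun φ => by
    rw [mul_assoc, exp_neg_sq_mul_weight, exp_neg_sq_mul_weight]
  simp_rw [hw]
  rw [integral_weight_eq_gaussNorm, integral_weight_eq_gaussNorm, B2Eq228Conditioning.gaussNorm_eq hP',
    B2Eq228Conditioning.gaussNorm_eq hP]
  have h1 : 0 < Real.sqrt (2 * Real.pi) ^ Fintype.card S := pow_pos (Real.sqrt_pos.2 (by positivity)) _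
  have h2 : 0 < Real.sqrt P.det := Real.sqrt_pos.2 hP.det_pos
  have h3 : 0 < Real.sqrt (P + Matrix.single b b 2 + Matrix.single a a 2).det := Real.sqrt_pos.2 hP'.det_pos
  field_simp

end Gauss

/-! ## §2 The interpolated form at a corner, for a general cube map -/
section Corner

variable {α I : Type} [Fintype α] [DecidableEq α] [Fintype I] [DecidableEq I] (blk : α → I)

/-- entries of `Δ_{1_Λ}` for a general cube map: intra-cube entries kept, inter-cube entries kept iff both cubes are in `Λ`.
[cite: BalabanImbrieJaffe1988, p.305 (Sect. 5.13)] -/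
theorem interpForm_corner_apply (M : Matrix α α ℝ) (Λ : Finset I) (x y : α) :
    interpForm blk M (corner ℝ Λ) x y = if blk x = blk y then M x y else if blk x ∈ Λ ∧ blk y ∈ Λ then M x y else 0 := by
  rw [interpForm_apply]
  by_cases h : blk x = blk y
  · simp [h]
  · simp only [if_neg h, corner_apply]
    by_cases hx : blk x ∈ Λ <;> by_cases hy : blk y ∈ Λ <;> simp [hx, hy]

/-- at the full corner the interpolated form is the form itself. [cite: BalabanImbrieJaffe1988, p.305 (Sect. 5.13)] -/
theorem interpForm_corner_univ (M : Matrix α α ℝ) : interpForm blk M (corner ℝ (univ : Finset I)) = M := by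
  have h : corner ℝ (univ : Finset I) = fun _ => (1 : ℝ) := by ext i; simp [corner_apply]
  rw [h, interpForm_one]

end Corner

/-! ## §3 The datum: the chain `□₀–□₁–□₂` with a TWO-site middle cube and the SPLIT precision -/
section Datum4

/-- **the split precision** is positive definite with the form bound `Δ ≥ ½·1`. [cite: BalabanImbrieJaffe1988, p.305 (Sect. 5.13)] -/
theorem split4_posDef_and_ge :
    ((!![2, 1, 0, 0; 1, 2, 0, 0; 0, 0, 2, 1; 0, 0, 1, 2] : Matrix (Fin 4) (Fin 4) ℝ)).PosDef ∧
      ∀ φ : Fin 4 → ℝ, (1 / 2) * (φ ⬝ᵥ φ) ≤ φ ⬝ᵥ ((!![2, 1, 0, 0; 1, 2, 0, 0; 0, 0, 2, 1; 0, 0, 1, 2] : Matrix (Fin 4) (Fin 4) ℝ) *ᵥ φ) := by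
  have hq : ∀ φ : Fin 4 → ℝ, φ ⬝ᵥ ((!![2, 1, 0, 0; 1, 2, 0, 0; 0, 0, 2, 1; 0, 0, 1, 2] : Matrix (Fin 4) (Fin 4) ℝ) *ᵥ φ) =
      2 * φ 0 ^ 2 + 2 * φ 1 ^ 2 + 2 * φ 2 ^ 2 + 2 * φ 3 ^ 2 + 2 * φ 0 * φ 1 + 2 * φ 2 * φ 3 := fun φ => by
    simp [Matrix.mulVec, dotProduct, Fin.sum_univ_four]; ring
  have hn : ∀ φ : Fin 4 → ℝ, φ ⬝ᵥ φ = φ 0 ^ 2 + φ 1 ^ 2 + φ 2 ^ 2 + φ 3 ^ 2 := fun φ => by simp [dotProduct, Fin.sum_univ_four]; ring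
  have hge : ∀ φ : Fin 4 → ℝ, (1 / 2) * (φ ⬝ᵥ φ) ≤ φ ⬝ᵥ ((!![2, 1, 0, 0; 1, 2, 0, 0; 0, 0, 2, 1; 0, 0, 1, 2] : Matrix (Fin 4) (Fin 4) ℝ) *ᵥ φ) := fun φ => by
    rw [hq, hn]
    nlinarith [sq_nonneg (3 * φ 0 + 2 * φ 1), sq_nonneg (3 * φ 3 + 2 * φ 2), sq_nonneg (φ 1), sq_nonneg (φ 2)]
  refine ⟨?_, hge⟩
  rw [Matrix.posDef_iff_dotProduct_mulVec]
  refine ⟨Matrix.IsHermitian.ext fun i j => by fin_cases i <;> fin_cases j <;> simp, fun x hx => ?_⟩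
  rw [star_trivial]
  have hpos : 0 < x ⬝ᵥ x := by
    rw [hn]
    have : x 0 ≠ 0 ∨ x 1 ≠ 0 ∨ x 2 ≠ 0 ∨ x 3 ≠ 0 := by
      by_contra h
      push Not at h
      exact hx (by ext i; fin_cases i <;> simp [h.1, h.2.1, h.2.2.1, h.2.2.2])
    rcases this with h | h | h | h <;> positivity
  linarith [hge x]

/-- transport of the region precisions to `Fin 4`: determinants of `N|_sites` and of `N|_sites + 2E_{22} + 2E_{11}`. [cite: BalabanImbrieJaffe1988, p.305 (Sect. 5.13)] -/
theorem det_submatrix_univ4 (N : Matrix (Fin 4) (Fin 4) ℝ) :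
    (N.submatrix (Subtype.val : BIJ88PolymerRep5134Gauss.Site (![0, 1, 1, 2] : Fin 4 → Fin 3) (univ : Finset (Fin 3)) → Fin 4) Subtype.val).det = N.det ∧
    (N.submatrix (Subtype.val : BIJ88PolymerRep5134Gauss.Site (![0, 1, 1, 2] : Fin 4 → Fin 3) (univ : Finset (Fin 3)) → Fin 4) Subtype.val +
        Matrix.single (⟨2, mem_univ _⟩ : BIJ88PolymerRep5134Gauss.Site (![0, 1, 1, 2] : Fin 4 → Fin 3) (univ : Finset (Fin 3)))
          (⟨2, mem_univ _⟩ : BIJ88PolymerRep5134Gauss.Site (![0, 1, 1, 2] : Fin 4 → Fin 3) (univ : Finset (Fin 3))) 2 +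
        Matrix.single (⟨1, mem_univ _⟩ : BIJ88PolymerRep5134Gauss.Site (![0, 1, 1, 2] : Fin 4 → Fin 3) (univ : Finset (Fin 3)))
          (⟨1, mem_univ _⟩ : BIJ88PolymerRep5134Gauss.Site (![0, 1, 1, 2] : Fin 4 → Fin 3) (univ : Finset (Fin 3))) 2).det =
      (N + Matrix.single 2 2 2 + Matrix.single 1 1 2).det := by
  have hmem : ∀ z : Fin 4, ((![0, 1, 1, 2] : Fin 4 → Fin 3) z) ∈ (univ : Finset (Fin 3)) := fun z => mem_univ _
  set e : BIJ88PolymerRep5134Gauss.Site (![0, 1, 1, 2] : Fin 4 → Fin 3) (univ : Finset (Fin 3)) ≃ Fin 4 := Equiv.subtypeUnivEquiv hmem with he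
  have hval : (Subtype.val : BIJ88PolymerRep5134Gauss.Site (![0, 1, 1, 2] : Fin 4 → Fin 3) (univ : Finset (Fin 3)) → Fin 4) = e := rfl
  refine ⟨by rw [hval, Matrix.det_submatrix_equiv_self], ?_⟩
  have h1 : (⟨1, mem_univ _⟩ : BIJ88PolymerRep5134Gauss.Site (![0, 1, 1, 2] : Fin 4 → Fin 3) (univ : Finset (Fin 3))) = e.symm 1 := rfl
  have h2 : (⟨2, mem_univ _⟩ : BIJ88PolymerRep5134Gauss.Site (![0, 1, 1, 2] : Fin 4 → Fin 3) (univ : Finset (Fin 3))) = e.symm 2 := rfl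
  rw [hval, h1, h2, ← Matrix.submatrix_single_equiv e e, ← Matrix.submatrix_single_equiv e e,
    show N.submatrix e e + (Matrix.single 2 2 (2 : ℝ)).submatrix e e + (Matrix.single 1 1 (2 : ℝ)).submatrix e e =
      (N + Matrix.single 2 2 2 + Matrix.single 1 1 2).submatrix e e from rfl,
    Matrix.det_submatrix_equiv_self]

/-- `⟨e^{−φ₁²}e^{−φ₂²}⟩` (the two faces of `□₁`) under the law of the fields of the three cubes at the corner `1_{Λ′}` of the split precision:
`√(det Δ_{1_{Λ′}} / det(Δ_{1_{Λ′}} + 2E₂₂ + 2E₁₁))`. [cite: BalabanImbrieJaffe1988, p.306 (Sect. 5.13); (5.14.3) p.309] -/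
theorem integral_exp_neg_sq_sq_regionLaw4 (Λ' : Finset (Fin 3)) :
    ∫ ω, Real.exp (-(ω ⟨1, mem_univ _⟩) ^ 2) * Real.exp (-(ω ⟨2, mem_univ _⟩) ^ 2)
        ∂(regionLaw (![0, 1, 1, 2] : Fin 4 → Fin 3) (!![2, 1, 0, 0; 1, 2, 0, 0; 0, 0, 2, 1; 0, 0, 1, 2] : Matrix (Fin 4) (Fin 4) ℝ) (0 : Fin 4 → ℝ) (univ : Finset (Fin 3)) Λ') =
      Real.sqrt (interpForm (![0, 1, 1, 2] : Fin 4 → Fin 3) (!![2, 1, 0, 0; 1, 2, 0, 0; 0, 0, 2, 1; 0, 0, 1, 2] : Matrix (Fin 4) (Fin 4) ℝ) (corner ℝ Λ')).det /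
        Real.sqrt (interpForm (![0, 1, 1, 2] : Fin 4 → Fin 3) (!![2, 1, 0, 0; 1, 2, 0, 0; 0, 0, 2, 1; 0, 0, 1, 2] : Matrix (Fin 4) (Fin 4) ℝ) (corner ℝ Λ') +
          Matrix.single 2 2 2 + Matrix.single 1 1 2).det := by
  obtain ⟨hΔ, -⟩ := split4_posDef_and_ge
  have hsrc : ∀ φ : BIJ88PolymerRep5134Gauss.Site (![0, 1, 1, 2] : Fin 4 → Fin 3) (univ : Finset (Fin 3)) → ℝ,
      source (src (![0, 1, 1, 2] : Fin 4 → Fin 3) (0 : Fin 4 → ℝ) (univ : Finset (Fin 3))) φ = 1 := fun φ => by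
    simp [source, BIJ88PolymerRep5134Gauss.src]
  have hP := prec_corner_posDef (![0, 1, 1, 2] : Fin 4 → Fin 3) (!![2, 1, 0, 0; 1, 2, 0, 0; 0, 0, 2, 1; 0, 0, 1, 2] : Matrix (Fin 4) (Fin 4) ℝ) hΔ (univ : Finset (Fin 3)) Λ'
  rw [regionLaw, integral_fieldLaw, prec_interp_corner]
  simp only [hsrc, mul_one]
  rw [integral_exp_neg_sq_sq_div _ hP ⟨1, mem_univ _⟩ ⟨2, mem_univ _⟩]
  obtain ⟨h1, h2⟩ := det_submatrix_univ4 (interpForm (![0, 1, 1, 2] : Fin 4 → Fin 3) (!![2, 1, 0, 0; 1, 2, 0, 0; 0, 0, 2, 1; 0, 0, 1, 2] : Matrix (Fin 4) (Fin 4) ℝ) (corner ℝ Λ'))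
  rw [show prec (![0, 1, 1, 2] : Fin 4 → Fin 3) (!![2, 1, 0, 0; 1, 2, 0, 0; 0, 0, 2, 1; 0, 0, 1, 2] : Matrix (Fin 4) (Fin 4) ℝ) (univ : Finset (Fin 3)) (corner ℝ Λ') =
      (interpForm (![0, 1, 1, 2] : Fin 4 → Fin 3) (!![2, 1, 0, 0; 1, 2, 0, 0; 0, 0, 2, 1; 0, 0, 1, 2] : Matrix (Fin 4) (Fin 4) ℝ) (corner ℝ Λ')).submatrix Subtype.val Subtype.val
      from rfl, h1, h2]

/-- **the eight corner forms of the split chain come in four coupling patterns**: both bonds (`1_{{0,1,2}}`), bond `□₀–□₁` only (`1_{{0,1}}`), bond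
`□₁–□₂` only (`1_{{1,2}}`), no bond (`1_{{0,2}}`, `1_{{0}}`, `1_{{1}}`, `1_{{2}}`, `1_∅`). [cite: BalabanImbrieJaffe1988, p.305 (Sect. 5.13)] -/
theorem interpForm_split4_corners :
    interpForm (![0, 1, 1, 2] : Fin 4 → Fin 3) (!![2, 1, 0, 0; 1, 2, 0, 0; 0, 0, 2, 1; 0, 0, 1, 2] : Matrix (Fin 4) (Fin 4) ℝ) (corner ℝ (univ : Finset (Fin 3))) =
        (!![2, 1, 0, 0; 1, 2, 0, 0; 0, 0, 2, 1; 0, 0, 1, 2] : Matrix (Fin 4) (Fin 4) ℝ) ∧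
      interpForm (![0, 1, 1, 2] : Fin 4 → Fin 3) (!![2, 1, 0, 0; 1, 2, 0, 0; 0, 0, 2, 1; 0, 0, 1, 2] : Matrix (Fin 4) (Fin 4) ℝ) (corner ℝ ({0, 1} : Finset (Fin 3))) = !![2, 1, 0, 0; 1, 2, 0, 0; 0, 0, 2, 0; 0, 0, 0, 2] ∧
      interpForm (![0, 1, 1, 2] : Fin 4 → Fin 3) (!![2, 1, 0, 0; 1, 2, 0, 0; 0, 0, 2, 1; 0, 0, 1, 2] : Matrix (Fin 4) (Fin 4) ℝ) (corner ℝ ({1, 2} : Finset (Fin 3))) = !![2, 0, 0, 0; 0, 2, 0, 0; 0, 0, 2, 1; 0, 0, 1, 2] ∧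
      (∀ Λ' ∈ ({{0, 2}, {0}, {1}, {2}, ∅} : Finset (Finset (Fin 3))),
        interpForm (![0, 1, 1, 2] : Fin 4 → Fin 3) (!![2, 1, 0, 0; 1, 2, 0, 0; 0, 0, 2, 1; 0, 0, 1, 2] : Matrix (Fin 4) (Fin 4) ℝ) (corner ℝ Λ') = !![2, 0, 0, 0; 0, 2, 0, 0; 0, 0, 2, 0; 0, 0, 0, 2]) := by
  refine ⟨interpForm_corner_univ (![0, 1, 1, 2] : Fin 4 → Fin 3) _, ?_, ?_, ?_⟩
  · ext x y; rw [interpForm_corner_apply]; fin_cases x <;> fin_cases y <;> simp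
  · ext x y; rw [interpForm_corner_apply]; fin_cases x <;> fin_cases y <;> simp
  · intro Λ' hΛ'
    simp only [Finset.mem_insert, Finset.mem_singleton] at hΛ'
    rcases hΛ' with rfl | rfl | rfl | rfl | rfl <;>
      (ext x y; rw [interpForm_corner_apply]; fin_cases x <;> fin_cases y <;> simp)

/-- `succAbove 1 2 = 3` in `Fin 4` (Laplace expansion bookkeeping; private plumbing). [folklore] -/
private theorem succAbove_one_two : Fin.succAbove (1 : Fin 4) (2 : Fin 3) = 3 := by decide

/-- the eight determinants: `9, 49` (both bonds), `12, 56` (one bond, either), `16, 64` (no bond) — Gaussian values `3/7`, `√(12/56) = √(3/14)`, `4/8`,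
i.e. the one-site values `√(3/7)` (coupled pair) and `√(1/2)` (free site) of gen 17, multiplied face by face. [cite: BalabanImbrieJaffe1988, p.305 (Sect. 5.13)] -/
theorem split4_dets :
    ((!![2, 1, 0, 0; 1, 2, 0, 0; 0, 0, 2, 1; 0, 0, 1, 2] : Matrix (Fin 4) (Fin 4) ℝ)).det = 9 ∧
      ((!![2, 1, 0, 0; 1, 2, 0, 0; 0, 0, 2, 1; 0, 0, 1, 2] : Matrix (Fin 4) (Fin 4) ℝ) + Matrix.single 2 2 2 + Matrix.single 1 1 2).det = 49 ∧
    (!![2, 1, 0, 0; 1, 2, 0, 0; 0, 0, 2, 0; 0, 0, 0, 2] : Matrix (Fin 4) (Fin 4) ℝ).det = 12 ∧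
      ((!![2, 1, 0, 0; 1, 2, 0, 0; 0, 0, 2, 0; 0, 0, 0, 2] : Matrix (Fin 4) (Fin 4) ℝ) + Matrix.single 2 2 2 + Matrix.single 1 1 2).det = 56 ∧
    (!![2, 0, 0, 0; 0, 2, 0, 0; 0, 0, 2, 1; 0, 0, 1, 2] : Matrix (Fin 4) (Fin 4) ℝ).det = 12 ∧
      ((!![2, 0, 0, 0; 0, 2, 0, 0; 0, 0, 2, 1; 0, 0, 1, 2] : Matrix (Fin 4) (Fin 4) ℝ) + Matrix.single 2 2 2 + Matrix.single 1 1 2).det = 56 ∧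
    (!![2, 0, 0, 0; 0, 2, 0, 0; 0, 0, 2, 0; 0, 0, 0, 2] : Matrix (Fin 4) (Fin 4) ℝ).det = 16 ∧
      ((!![2, 0, 0, 0; 0, 2, 0, 0; 0, 0, 2, 0; 0, 0, 0, 2] : Matrix (Fin 4) (Fin 4) ℝ) + Matrix.single 2 2 2 + Matrix.single 1 1 2).det = 64 := by
  have e1 : (!![2, 1, 0, 0; 1, 2, 0, 0; 0, 0, 2, 1; 0, 0, 1, 2] : Matrix (Fin 4) (Fin 4) ℝ) + Matrix.single 2 2 2 + Matrix.single 1 1 2 = !![2, 1, 0, 0; 1, 4, 0, 0; 0, 0, 4, 1; 0, 0, 1, 2] := by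
    ext i j; fin_cases i <;> fin_cases j <;> norm_num [Matrix.single_apply, Fin.ext_iff]
  have e2 : (!![2, 1, 0, 0; 1, 2, 0, 0; 0, 0, 2, 0; 0, 0, 0, 2] : Matrix (Fin 4) (Fin 4) ℝ) + Matrix.single 2 2 2 + Matrix.single 1 1 2 =
      !![2, 1, 0, 0; 1, 4, 0, 0; 0, 0, 4, 0; 0, 0, 0, 2] := by
    ext i j; fin_cases i <;> fin_cases j <;> norm_num [Matrix.single_apply, Fin.ext_iff]
  have e3 : (!![2, 0, 0, 0; 0, 2, 0, 0; 0, 0, 2, 1; 0, 0, 1, 2] : Matrix (Fin 4) (Fin 4) ℝ) + Matrix.single 2 2 2 + Matrix.single 1 1 2 =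
      !![2, 0, 0, 0; 0, 4, 0, 0; 0, 0, 4, 1; 0, 0, 1, 2] := by
    ext i j; fin_cases i <;> fin_cases j <;> norm_num [Matrix.single_apply, Fin.ext_iff]
  have e4 : (!![2, 0, 0, 0; 0, 2, 0, 0; 0, 0, 2, 0; 0, 0, 0, 2] : Matrix (Fin 4) (Fin 4) ℝ) + Matrix.single 2 2 2 + Matrix.single 1 1 2 =
      !![2, 0, 0, 0; 0, 4, 0, 0; 0, 0, 4, 0; 0, 0, 0, 2] := by
    ext i j; fin_cases i <;> fin_cases j <;> norm_num [Matrix.single_apply, Fin.ext_iff]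
  rw [e1, e2, e3, e4]
  refine ⟨?_, ?_, ?_, ?_, ?_, ?_, ?_, ?_⟩
  · simp [Matrix.det_succ_row_zero, Fin.sum_univ_succ, succAbove_one_two]; norm_num
  · simp [Matrix.det_succ_row_zero, Fin.sum_univ_succ, succAbove_one_two]; norm_num
  · simp [Matrix.det_succ_row_zero, Fin.sum_univ_succ, succAbove_one_two]; norm_num
  · simp [Matrix.det_succ_row_zero, Fin.sum_univ_succ, succAbove_one_two]; norm_num
  · simp [Matrix.det_succ_row_zero, Fin.sum_univ_succ]; norm_num
  · simp [Matrix.det_succ_row_zero, Fin.sum_univ_succ]; norm_num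
  · simp [Matrix.det_succ_row_zero, Fin.sum_univ_succ]; norm_num
  · simp [Matrix.det_succ_row_zero, Fin.sum_univ_succ]; norm_num

/-- **RANGE-ONE COVARIANCE AT EVERY INTERPOLATION**: for every `s ∈ [0,1]³` the covariance `(Δ_s)⁻¹` of the split datum has NO entry between two
distinct sites that `Δ` does not couple directly — in particular none between `□₀` (or the `□₀`-face of `□₁`) and `□₂` (or the `□₂`-face of `□₁`):
`Δ_s = [[2,s₀s₁],[s₁s₀,2]] ⊕ [[2,s₁s₂],[s₂s₁,2]]` is block diagonal and so is its inverse (explicit).  This is the strongest form of an inter-cube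
covariance-DECAY letter (decay length zero beyond the coupling range). [cite: BalabanImbrieJaffe1988, p.305–307 (Sect. 5.13)] -/
theorem split4_inv_offBlock (s : Fin 3 → ℝ) (hs : ∀ i, 0 ≤ s i ∧ s i ≤ 1) (x y : Fin 4) (hxy : x ≠ y) (hΔ : (!![2, 1, 0, 0; 1, 2, 0, 0; 0, 0, 2, 1; 0, 0, 1, 2] : Matrix (Fin 4) (Fin 4) ℝ) x y = 0) :
    (interpForm (![0, 1, 1, 2] : Fin 4 → Fin 3) (!![2, 1, 0, 0; 1, 2, 0, 0; 0, 0, 2, 1; 0, 0, 1, 2] : Matrix (Fin 4) (Fin 4) ℝ) s)⁻¹ x y = 0 := by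
  have hA : interpForm (![0, 1, 1, 2] : Fin 4 → Fin 3) (!![2, 1, 0, 0; 1, 2, 0, 0; 0, 0, 2, 1; 0, 0, 1, 2] : Matrix (Fin 4) (Fin 4) ℝ) s = !![2, s 0 * s 1, 0, 0; s 1 * s 0, 2, 0, 0; 0, 0, 2, s 1 * s 2; 0, 0, s 2 * s 1, 2] := by
    ext i j; fin_cases i <;> fin_cases j <;> simp [interpForm_apply]
  have hsq : ∀ i j : Fin 3, s i ^ 2 * s j ^ 2 ≤ 1 := fun i j => by
    have hi := hs i; have hj := hs j
    exact mul_le_one₀ (by nlinarith) (sq_nonneg _) (by nlinarith)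
  have hk1 : 4 - s 0 ^ 2 * s 1 ^ 2 ≠ 0 := by linarith [hsq 0 1]
  have hk1' : 4 - s 1 ^ 2 * s 0 ^ 2 ≠ 0 := by linarith [hsq 1 0]
  have hk2 : 4 - s 1 ^ 2 * s 2 ^ 2 ≠ 0 := by linarith [hsq 1 2]
  have hk2' : 4 - s 2 ^ 2 * s 1 ^ 2 ≠ 0 := by linarith [hsq 2 1]
  have hN : interpForm (![0, 1, 1, 2] : Fin 4 → Fin 3) (!![2, 1, 0, 0; 1, 2, 0, 0; 0, 0, 2, 1; 0, 0, 1, 2] : Matrix (Fin 4) (Fin 4) ℝ) s *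
      !![2 / (4 - (s 0 * s 1) ^ 2), -(s 0 * s 1) / (4 - (s 0 * s 1) ^ 2), 0, 0;
        -(s 0 * s 1) / (4 - (s 0 * s 1) ^ 2), 2 / (4 - (s 0 * s 1) ^ 2), 0, 0;
        0, 0, 2 / (4 - (s 1 * s 2) ^ 2), -(s 1 * s 2) / (4 - (s 1 * s 2) ^ 2);
        0, 0, -(s 1 * s 2) / (4 - (s 1 * s 2) ^ 2), 2 / (4 - (s 1 * s 2) ^ 2)] = 1 := by
    rw [hA]
    ext i j
    fin_cases i <;> fin_cases j <;> simp [Matrix.mul_apply, Fin.sum_univ_four] <;> (field_simp; ring)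
  rw [Matrix.inv_eq_right_inv hN]
  fin_cases x <;> fin_cases y <;> first | exact absurd rfl hxy | (norm_num at hΔ; done) | norm_num

/-- the numerical windows: `√9/√49 = 3/7`, `√16/√64 = 1/2`, `√12/√56 ≤ 0.463`. [cite: BalabanImbrieJaffe1988, (5.14.4) p.309] -/
theorem sqrt_windows4 :
    Real.sqrt 9 / Real.sqrt 49 = 3 / 7 ∧ Real.sqrt 16 / Real.sqrt 64 = 1 / 2 ∧ Real.sqrt 12 / Real.sqrt 56 ≤ 463 / 1000 := by
  refine ⟨?_, ?_, ?_⟩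
  · rw [show (9 : ℝ) = 3 ^ 2 by norm_num, show (49 : ℝ) = 7 ^ 2 by norm_num, Real.sqrt_sq (by norm_num), Real.sqrt_sq (by norm_num)]
  · rw [show (16 : ℝ) = 4 ^ 2 by norm_num, show (64 : ℝ) = 8 ^ 2 by norm_num, Real.sqrt_sq (by norm_num), Real.sqrt_sq (by norm_num)]
    norm_num
  · rw [← Real.sqrt_div (by norm_num : (0 : ℝ) ≤ 12)]
    calc Real.sqrt (12 / 56) ≤ Real.sqrt ((463 / 1000) ^ 2) := Real.sqrt_le_sqrt (by norm_num)
      _ = 463 / 1000 := Real.sqrt_sq (by norm_num)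

end Datum4

end Literature.MathematicalPhysics.QuantumFieldTheory.BalabanImbrieJaffe1984to88.BIJ88TripleSplitActivity309

end
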